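import Summits.ResolutionOfSingularities.ResolutionOfSingularities.Theorems.FrobeniusLadderFRationalResolutionFixedPointFibre
import HarnessLib

/-!
# Crux `FrobeniusLadder.FRationalResolution` (stmt-ResolutionOfSingularities-15317), line `redirect`,
# stub `stub_diagonalizableQuotientResolution` — the GENERIC STABILISER of a point of the quotient
# chart: the degrees carrying a homogeneous unit at `𝔔` form a subgroup `B_𝔔 ≤ A`, and `𝔔` is a
# fixed point for every degree outside `B_𝔔` (entrance of the reduction of NON-fixed points to the
# fixed-point milestone `…FixedPointLogRegular.lean` applied to the coarsened `A/B_𝔔`-grading)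

For `S` graded by a torsion abelian group `A` and a prime `𝔔` of `S`, let
`B_𝔔 = {a ∈ A : some s ∈ S_a lies outside 𝔔}` (the degrees in which `S_𝔔` has a homogeneous
unit; `D(A/B_𝔔) ⊆ D(A)` is the stabiliser of the point `𝔔`). Then:

* `exists_unitDegrees_addSubgroup` — **`B_𝔔` is a subgroup of `A`** (products of elements outside
  the prime `𝔔` stay outside; inverses from torsion: `s^{ord a − 1} ∈ S_{−a}`), and every degree
  `a ∉ B_𝔔` has `S_a ⊆ 𝔔` — so `𝔔` contains every homogeneous piece whose degree is non-zero in
  `A/B_𝔔`: it is a FIXED prime for the coarsened grading, where `exists_isLogRegularAt_of_fixed`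
  applies (with degree-`0` part `S^{(B_𝔔)} = ⊕_{b ∈ B_𝔔} S_b ⊇ S₀`, a `D(B_𝔔)`-torsor over `S₀`
  near `𝔮` since every `b ∈ B_𝔔` carries a unit);
* `unitDegrees_eq_bot_iff` — `B_𝔔 = 0` iff `𝔔` is a `D(A)`-fixed point (`S_a ⊆ 𝔔` for all `a ≠ 0`).

Honest label: elementary entrance of the non-fixed-point reduction (no stub closed; the coarsened
grading and the torsor descent are not constructed here). No definitions, no named facts, no sorry.
[folklore; cite: SGA3, Exp. VIII §4–5]
-/

noncomputable section

-- single-problem summit: the doubled namespace component is forced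
set_option linter.dupNamespace false

namespace Summit.ResolutionOfSingularities.ResolutionOfSingularities.Theorems.FRationalResolution.StabilizerSubgroup

universe u v w

variable {R : Type u} {S : Type v} {A : Type w} [CommRing R] [CommRing S] [Algebra R S]
  [DecidableEq A] [AddCommGroup A] (𝒮 : A → Submodule R S) [GradedAlgebra 𝒮]

/-- **The degrees carrying a homogeneous unit at `𝔔` form a subgroup** `B_𝔔 ≤ A` (torsion
grading), and `S_a ⊆ 𝔔` for every `a ∉ B_𝔔`. [folklore; cite: SGA3, Exp. VIII §4–5] -/
theorem exists_unitDegrees_addSubgroup (hA : AddMonoid.IsTorsion A) (𝔔 : Ideal S) [𝔔.IsPrime] :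
    ∃ B : AddSubgroup A, (∀ a : A, a ∈ B ↔ ∃ s ∈ 𝒮 a, s ∉ 𝔔) ∧
      ∀ a : A, a ∉ B → ∀ s ∈ 𝒮 a, s ∈ 𝔔 := by
  classical
  have hone : ∃ s ∈ 𝒮 (0 : A), s ∉ 𝔔 :=
    ⟨1, SetLike.one_mem_graded 𝒮, fun h1 =>
      (inferInstance : 𝔔.IsPrime).ne_top ((Ideal.eq_top_iff_one 𝔔).mpr h1)⟩
  have hmul : ∀ {a b : A}, (∃ s ∈ 𝒮 a, s ∉ 𝔔) → (∃ s ∈ 𝒮 b, s ∉ 𝔔) →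
      ∃ s ∈ 𝒮 (a + b), s ∉ 𝔔 := by
    rintro a b ⟨s, hs, hsQ⟩ ⟨t, ht, htQ⟩
    refine ⟨s * t, SetLike.mul_mem_graded hs ht, fun hst => ?_⟩
    rcases (inferInstance : 𝔔.IsPrime).mem_or_mem hst with h | h
    · exact hsQ h
    · exact htQ h
  have hneg : ∀ {a : A}, (∃ s ∈ 𝒮 a, s ∉ 𝔔) → ∃ s ∈ 𝒮 (-a), s ∉ 𝔔 := by
    rintro a ⟨s, hs, hsQ⟩
    set n := addOrderOf a with hn
    have hnpos : 0 < n := (hA a).addOrderOf_pos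
    have hpow : s ^ (n - 1) ∈ 𝒮 ((n - 1) • a) := SetLike.pow_mem_graded (n - 1) hs
    have hdeg : (n - 1) • a = -a := by
      rw [eq_neg_iff_add_eq_zero, ← succ_nsmul, Nat.sub_add_cancel hnpos, hn]
      exact addOrderOf_nsmul_eq_zero a
    rw [hdeg] at hpow
    exact ⟨s ^ (n - 1), hpow, fun h => hsQ ((inferInstance : 𝔔.IsPrime).mem_of_pow_mem _ h)⟩
  let B : AddSubgroup A :=
    { carrier := {a | ∃ s ∈ 𝒮 a, s ∉ 𝔔},
      zero_mem' := hone,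
      add_mem' := fun ha hb => hmul ha hb,
      neg_mem' := fun ha => hneg ha }
  refine ⟨B, fun a => Iff.rfl, fun a ha s hs => ?_⟩
  by_contra hsQ
  exact ha ⟨s, hs, hsQ⟩

omit [DecidableEq A] [GradedAlgebra 𝒮] in
/-- **`B_𝔔 = 0` iff `𝔔` is a fixed point**: every degree with a homogeneous element outside `𝔔` is
zero iff `S_a ⊆ 𝔔` for all `a ≠ 0`. [folklore] -/
theorem unitDegrees_eq_bot_iff (𝔔 : Ideal S) (B : AddSubgroup A)
    (hB : ∀ a : A, a ∈ B ↔ ∃ s ∈ 𝒮 a, s ∉ 𝔔) :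
    B = ⊥ ↔ ∀ a : A, a ≠ 0 → ∀ s ∈ 𝒮 a, s ∈ 𝔔 := by
  constructor
  · intro h a ha s hs
    by_contra hsQ
    have haB : a ∈ B := (hB a).mpr ⟨s, hs, hsQ⟩
    rw [h] at haB
    exact ha haB
  · intro h
    rw [eq_bot_iff]
    intro a haB
    obtain ⟨s, hs, hsQ⟩ := (hB a).mp haB
    by_contra ha0
    exact hsQ (h a ha0 s hs)

omit [DecidableEq A] [GradedAlgebra 𝒮] in
/-- At a degree `b ∈ B_𝔔` the local ring `S_𝔔` — and every localization in which the elements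
outside `𝔔` become units — has a HOMOGENEOUS UNIT of degree `b` (restatement for consumers: the
image of the witness is a unit). [folklore] -/
theorem isUnit_of_mem_unitDegrees (𝔔 : Ideal S) [𝔔.IsPrime] (B : AddSubgroup A)
    (hB : ∀ a : A, a ∈ B ↔ ∃ s ∈ 𝒮 a, s ∉ 𝔔) {b : A} (hb : b ∈ B)
    (L : Type v) [CommRing L] [Algebra S L] [IsLocalization.AtPrime L 𝔔] :
    ∃ s ∈ 𝒮 b, IsUnit (algebraMap S L s) := by
  obtain ⟨s, hs, hsQ⟩ := (hB b).mp hb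
  exact ⟨s, hs, IsLocalization.map_units L ⟨s, show s ∈ 𝔔.primeCompl from hsQ⟩⟩

end Summit.ResolutionOfSingularities.ResolutionOfSingularities.Theorems.FRationalResolution.StabilizerSubgroup

end
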